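import Summits.QuantumFields.QCD.Theses.PauliWegnerSea
import Summits.QuantumFields.QCD.Theorems.PauliWegnerSeaTiltedFlatness
import Literature.MathematicalPhysics.QuantumFieldTheory.QCDPhaseQuenched
import Literature.MathematicalPhysics.QuantumFieldTheory.QCDWickMinorMeasurability
import Literature.MathematicalPhysics.QuantumFieldTheory.QCDHeavyQuarkPropagator
import Literature.MeasureTheory.Integral.SmallBallNegativeMoments

/-!
# Stub `stub_fibreDominate` of line `adjugate-anticoncentration-pin`
(crux `Summit.QuantumFields.QCD.Theses.PauliWegnerSea.OneScaleTrajectory`, item stmt-QuantumFields-11513)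

**What is proved.** `stub_fibreDominate` (C2, FIBREWISE DOMINATION): granted the adjugate small balls
(B) (the registered text of `stub_adjugateSmallBall`, a hypothesis here), for every `N_f` there is
`r₁ > 0` and for `0 < r ≤ r₁` constants `C, P` (depending on `N_f` and on the constants of (B) and of
crux `TiltedFlatness` only) such that on every two-star fibre (`refit`: links of `star(x) ∪ star(y)`
free, the rest frozen to `U`; `β ≥ 0`, masses in `[-2,2]^{N_f}`, `L ≥ 4`), with `wt = e^{-β S_W ∘ refit}`,
product Haar, `X_f = Σ_{a,i,b,j} |D⁻¹_{(f,x,a,i),(f,y,b,j)}|` the propagator block, `A` the cofactor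
block of `D_W(m_f)`, `M_A = ∫ A wt / ∫ wt`, `M_f = ∫ |det D_W(m_f)| wt / ∫ wt`:
`∫⁻ |det D| X_f^{-r} wt ≤ C(1+β)^P (M_A/M_f)^{-r} ∫⁻ |det D| wt` (lower Lebesgue integrals in `ℝ≥0∞`).

**Proof.** (1) Off the walls `{det D = 0}` the inverse is flavour-diagonal and `D_W⁻¹ = adj/det`, so
`X_f = A/|det D_W(m_f)|` (`blockSum_eq_div`); on the walls the integrand is `0`.  (2) Crux
`TiltedFlatness` (PROVED, `CircleTransport.TiltedFlatness_proof`) at `N_f = 1`, flavour by flavour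
(`oneFlavour`): `|det D_W(m_g)| ≤ K M_g`, `K = C₃(1+β)^{p₃}`, and `ν(|det D_W(m_g)| ≤ εM_g) ≤ Kε^{c₃}`;
hence pointwise `|det D| X_f^{-r} ≤ K^{N_f}(∏_g M_g)(K M_f)^r · A^{-r}` in `ℝ≥0∞`
(`Literature…ofReal_mul_ofReal_div_rpow_neg`).  (3) (B) + layer cake
(`Literature…lintegral_rpow_neg_mul_le_of_smallBalls`, `r ≤ c/2`): `∫⁻ A^{-r} wt ≤ (1+C_B(1+β)^{p_B}) M_A^{-r} ∫ wt`.
(4) Union bound over flavours at `ε₀ = (2(N_f+1)K)^{-1/c₃}` and reverse Hölder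
(`Literature…pow_mul_prod_mul_integral_le_of_smallBalls`): `ε₀^{N_f}(∏_g M_g) ∫ wt ≤ 2 ∫ |det D| wt`.
(5) Assembly (`K^r ≤ K` as `r ≤ 1`): `C = 2C₃^{N_f+1}(1+C_B)(2(N_f+1)C₃)^{N_f/c₃}`,
`P = p₃(N_f+1) + p_B⁺ + p₃N_f/c₃`.  Degenerate fibres: `∫ |det D| wt = 0` gives `0 ≤ ·`, `M_A = 0` a `⊤`
right-hand side.  Sources: line card `adjugate-anticoncentration-pin` (route `PauliWegnerSea`); crux
file `PauliWegnerSeaTiltedFlatness.lean`; folklore measure theory (`SmallBallNegativeMoments.lean`).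
-/

noncomputable section

namespace Summit.QuantumFields.QCD.Theorems.AdjugateAnticoncentrationPin

open scoped BigOperators ENNReal
open MeasureTheory Filter Set
open Literature.MathematicalPhysics.QuantumFieldTheory Literature.MathematicalPhysics.QuantumLattice
  Literature.Probability.LatticeModels

/-! ### Crux `TiltedFlatness` at one flavour, let-free -/

/-- Crux `TiltedFlatness` (proved: `CircleTransport.TiltedFlatness_proof`) at `N_f = 1`, in let-free
form for an arbitrary `refit` with the defining property and the one-flavour sea
`F = |det D_W(refit ·; m₀)|`: flatness `F ≤ C(1+β)^p M` and relative small balls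
`∫ 1{F ≤ εM} wt / ∫ wt ≤ C(1+β)^p ε^c` (`M > 0`), with `C ≥ 1`, `p ≥ 0`, `c > 0` absolute. -/
private theorem oneFlavour : ∃ C p c : ℝ, 1 ≤ C ∧ 0 ≤ p ∧ 0 < c ∧ ∀ β : ℝ, 0 ≤ β →
    ∀ m₀ : ℝ, -2 ≤ m₀ → m₀ ≤ 2 →
    ∀ (N : ℕ) [NeZero N], 4 ≤ N → ∀ (U : GaugeConfig 4 N SU3) (x y : TorusSite 4 N)
      (refit : GaugeConfig 4 N SU3 → GaugeConfig 4 N SU3),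
      (∀ W e, refit W e = if e.1 = x ∨ Site.shift e.1 e.2 = x ∨ e.1 = y ∨ Site.shift e.1 e.2 = y
        then W e else U e) →
      ∀ (F wt : GaugeConfig 4 N SU3 → ℝ),
        (∀ W, F W = ‖(wilsonDirac (fundamentalRep (Fin 3)) (refit W) m₀ 1).det‖) →
        (∀ W, wt W = Real.exp (-(β * wilsonAction (fundamentalRep (Fin 3)) (refit W)))) →
        ∀ (haar : Measure (GaugeConfig 4 N SU3)), haar = Measure.pi (fun _ => haarProbability SU3) →
          (∀ W₀, F W₀ ≤ C * (1 + β) ^ p * ((∫ W, F W * wt W ∂haar) / ∫ W, wt W ∂haar)) ∧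
          (0 < (∫ W, F W * wt W ∂haar) / (∫ W, wt W ∂haar) → ∀ ε : ℝ, 0 < ε →
            (∫ W, (if F W ≤ ε * ((∫ W, F W * wt W ∂haar) / ∫ W, wt W ∂haar) then (1 : ℝ) else 0) *
                wt W ∂haar) / (∫ W, wt W ∂haar) ≤ C * (1 + β) ^ p * ε ^ c) := by
  obtain ⟨C, p, c, hC, hc, h⟩ := CircleTransport.TiltedFlatness_proof 1
  refine ⟨max C 1, max p 0, c, le_max_right _ _, le_max_right _ _, hc, ?_⟩
  intro β hβ m₀ hm₁ hm₂ N _ hN U x y refit hrefit F wt hF hwt haar hhaar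
  have hF' : F = fun W => ‖(diracMatrix (refit W) (fun _ : Fin 1 => m₀)).det‖ := by
    funext W
    rw [hF, norm_det_diracMatrix, Fin.prod_univ_one]
  subst hF'
  obtain rfl : wt = fun W => Real.exp (-(β * wilsonAction (fundamentalRep (Fin 3)) (refit W))) :=
    funext hwt
  subst hhaar
  obtain rfl : refit = fun W (e : Edge 4 N) =>
      if e.1 = x ∨ Site.shift e.1 e.2 = x ∨ e.1 = y ∨ Site.shift e.1 e.2 = y then W e else U e :=
    funext fun W => funext fun e => hrefit W e
  have h1 := h β hβ (fun _ => m₀) (fun _ => ⟨hm₁, hm₂⟩) N hN U x y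
  have h1β : (1 : ℝ) ≤ 1 + β := by linarith
  have hCp : C * (1 + β) ^ p ≤ max C 1 * (1 + β) ^ max p 0 :=
    mul_le_mul (le_max_left _ _) (Real.rpow_le_rpow_of_exponent_le h1β (le_max_left _ _))
      (by positivity) (by positivity)
  refine ⟨fun W₀ => (h1.1 W₀).trans (mul_le_mul_of_nonneg_right hCp ?_),
    fun hM ε hε => (h1.2 hM ε hε).trans (mul_le_mul_of_nonneg_right hCp (by positivity))⟩
  exact div_nonneg (integral_nonneg fun W => mul_nonneg (norm_nonneg _) (Real.exp_pos _).le)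
    (integral_nonneg fun W => (Real.exp_pos _).le)

/-! ### The propagator block off the walls -/

/-- Off the walls `{det D_W(m_g) = 0}` the same-flavour `ℓ¹` colour–spin block of `D⁻¹` between `x`
and `y` is the cofactor block of `D_W(m_f)` over `|det D_W(m_f)|` (flavour-diagonal inverse
`inv_diracMatrix_apply_same_flavour` and `A⁻¹ = (det A)⁻¹ • adj A`). -/
private theorem blockSum_eq_div {Nf N : ℕ} [NeZero N] (V : GaugeConfig 4 N SU3) (mq : Fin Nf → ℝ)
    (f : Fin Nf) (x y : TorusSite 4 N)
    (h : ∀ g, (wilsonDirac (fundamentalRep (Fin 3)) V (mq g) 1).det ≠ 0) :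
    ∑ a : Fin 3, ∑ i : Fin 4, ∑ b : Fin 3, ∑ j : Fin 4,
        ‖(diracMatrix V mq)⁻¹ (quarkEquiv (f, (x, a, i))) (quarkEquiv (f, (y, b, j)))‖ =
      (∑ a : Fin 3, ∑ i : Fin 4, ∑ b : Fin 3, ∑ j : Fin 4,
        ‖(wilsonDirac (fundamentalRep (Fin 3)) V (mq f) 1).adjugate (x, a, i) (y, b, j)‖) /
        ‖(wilsonDirac (fundamentalRep (Fin 3)) V (mq f) 1).det‖ := by
  simp_rw [Finset.sum_div, inv_diracMatrix_apply_same_flavour V mq h f, Matrix.inv_def,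
    Matrix.smul_apply, smul_eq_mul, norm_mul, Ring.inverse_eq_inv, norm_inv, inv_mul_eq_div]

/-! ### The stub -/

/-- Registered stub `stub_fibreDominate` of line `adjugate-anticoncentration-pin` for crux stmt-QuantumFields-11513.
FIBREWISE DOMINATION (C2): granted the adjugate small balls (B), on every two-star fibre the
`|det D|`-weighted negative moment of the quark-propagator block `X_f` is controlled by the
fibre-smoothed scale `𝒮_f = M_A / M_f` alone: `E_ν[|det D| X_f^{-r}] ≤ C(1+β)^P 𝒮_f^{-r} E_ν[|det D|]`
for `0 < r ≤ r₁(N_f)`, written with lower Lebesgue integrals (no junk values: dead channels show as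
`⊤`, walls contribute `0`).  Source: line card `adjugate-anticoncentration-pin` (route
`PauliWegnerSea`), via crux `TiltedFlatness` flavour by flavour, the layer cake and a union bound.  THE STATEMENT BELOW IS REGISTERED — DO NOT CHANGE A CHARACTER OF IT. -/
theorem stub_fibreDominate :
    (∃ C p c : ℝ, 0 < C ∧ 0 < c ∧ ∀ β : ℝ, 0 ≤ β → ∀ m₀ : ℝ, -2 ≤ m₀ → m₀ ≤ 2 →
      ∀ (N : ℕ) [NeZero N], 4 ≤ N → ∀ (U : GaugeConfig 4 N SU3) (x y : TorusSite 4 N)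
        (refit : GaugeConfig 4 N SU3 → GaugeConfig 4 N SU3),
        (∀ W e, refit W e = if e.1 = x ∨ Site.shift e.1 e.2 = x ∨ e.1 = y ∨ Site.shift e.1 e.2 = y then W e else U e) →
        ∀ (A wt : GaugeConfig 4 N SU3 → ℝ),
          (∀ W, A W = ∑ a : Fin 3, ∑ i : Fin 4, ∑ b : Fin 3, ∑ j : Fin 4,
            ‖(wilsonDirac (fundamentalRep (Fin 3)) (refit W) m₀ 1).adjugate (x, a, i) (y, b, j)‖) →
          (∀ W, wt W = Real.exp (-(β * wilsonAction (fundamentalRep (Fin 3)) (refit W)))) →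
          ∀ (haar : Measure (GaugeConfig 4 N SU3)), haar = Measure.pi (fun _ => haarProbability SU3) →
          ∀ (M : ℝ), M = (∫ W, A W * wt W ∂haar) / ∫ W, wt W ∂haar → 0 < M → ∀ ε : ℝ, 0 < ε →
            (∫ W, (if A W ≤ ε * M then (1 : ℝ) else 0) * wt W ∂haar) / (∫ W, wt W ∂haar) ≤
              C * (1 + β) ^ p * ε ^ c) →
      ∀ Nf : ℕ, ∃ r₁ : ℝ, 0 < r₁ ∧ ∀ r : ℝ, 0 < r → r ≤ r₁ → ∃ C P : ℝ, 0 < C ∧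
        ∀ β : ℝ, 0 ≤ β → ∀ mq : Fin Nf → ℝ, (∀ g, -2 ≤ mq g ∧ mq g ≤ 2) →
          ∀ (N : ℕ) [NeZero N], 4 ≤ N → ∀ (U : GaugeConfig 4 N SU3) (x y : TorusSite 4 N) (f : Fin Nf)
            (refit : GaugeConfig 4 N SU3 → GaugeConfig 4 N SU3),
            (∀ W e, refit W e = if e.1 = x ∨ Site.shift e.1 e.2 = x ∨ e.1 = y ∨ Site.shift e.1 e.2 = y then W e else U e) →
            ∀ (wt : GaugeConfig 4 N SU3 → ℝ),
              (∀ W, wt W = Real.exp (-(β * wilsonAction (fundamentalRep (Fin 3)) (refit W)))) →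
              ∀ (haar : Measure (GaugeConfig 4 N SU3)), haar = Measure.pi (fun _ => haarProbability SU3) →
                ∫⁻ W, ENNReal.ofReal ‖(diracMatrix (refit W) mq).det‖ *
                    ENNReal.ofReal (∑ a : Fin 3, ∑ i : Fin 4, ∑ b : Fin 3, ∑ j : Fin 4,
                      ‖(diracMatrix (refit W) mq)⁻¹ (quarkEquiv (f, (x, a, i))) (quarkEquiv (f, (y, b, j)))‖) ^ (-r) *
                    ENNReal.ofReal (wt W) ∂haar ≤
                  ENNReal.ofReal (C * (1 + β) ^ P) *
                    ENNReal.ofReal (((∫ W, (∑ a : Fin 3, ∑ i : Fin 4, ∑ b : Fin 3, ∑ j : Fin 4,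
                        ‖(wilsonDirac (fundamentalRep (Fin 3)) (refit W) (mq f) 1).adjugate (x, a, i) (y, b, j)‖) * wt W ∂haar) /
                        ∫ W, wt W ∂haar) /
                      ((∫ W, ‖(wilsonDirac (fundamentalRep (Fin 3)) (refit W) (mq f) 1).det‖ * wt W ∂haar) /
                        ∫ W, wt W ∂haar)) ^ (-r) *
                    ∫⁻ W, ENNReal.ofReal ‖(diracMatrix (refit W) mq).det‖ * ENNReal.ofReal (wt W) ∂haar := by
  intro hB Nf
  obtain ⟨C_B, p_B, c, hCB, hc, hB⟩ := hB
  obtain ⟨C₃, p₃, c₃, hC₃, hp₃, hc₃, hT⟩ := oneFlavour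
  have hC₃0 : 0 < C₃ := one_pos.trans_le hC₃
  refine ⟨min (c / 2) 1, lt_min (half_pos hc) one_pos, fun r hr hr₁ => ?_⟩
  obtain ⟨hrc, hr1⟩ := le_min_iff.1 hr₁
  have hcr0 : 0 < c - r := by linarith
  set Cbig : ℝ := 2 * C₃ ^ (Nf + 1) * (1 + C_B) * (2 * (Nf + 1) * C₃) ^ ((Nf : ℝ) / c₃) with hCbig
  set P : ℝ := p₃ * (Nf + 1) + max p_B 0 + p₃ * ((Nf : ℝ) / c₃) with hPdef
  have hCbig0 : 0 < Cbig := by rw [hCbig]; positivity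
  refine ⟨Cbig, P, hCbig0, ?_⟩
  intro β hβ mq hmq N _ hN U x y f refit hrefit wt hwt haar hhaar
  -- names: one-flavour seas `Fg`, cofactor block `A`, propagator block `X`
  obtain ⟨Fg, hFg⟩ : ∃ Fg : Fin Nf → GaugeConfig 4 N SU3 → ℝ,
      ∀ g W, Fg g W = ‖(wilsonDirac (fundamentalRep (Fin 3)) (refit W) (mq g) 1).det‖ :=
    ⟨_, fun _ _ => rfl⟩
  obtain ⟨A, hA⟩ : ∃ A : GaugeConfig 4 N SU3 → ℝ, ∀ W, A W = ∑ a : Fin 3, ∑ i : Fin 4, ∑ b : Fin 3,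
      ∑ j : Fin 4, ‖(wilsonDirac (fundamentalRep (Fin 3)) (refit W) (mq f) 1).adjugate
        (x, a, i) (y, b, j)‖ := ⟨_, fun _ => rfl⟩
  obtain ⟨X, hX⟩ : ∃ X : GaugeConfig 4 N SU3 → ℝ, ∀ W, X W = ∑ a : Fin 3, ∑ i : Fin 4, ∑ b : Fin 3,
      ∑ j : Fin 4, ‖(diracMatrix (refit W) mq)⁻¹ (quarkEquiv (f, (x, a, i)))
        (quarkEquiv (f, (y, b, j)))‖ := ⟨_, fun _ => rfl⟩
  have hF : ∀ W, ‖(diracMatrix (refit W) mq).det‖ = ∏ g, Fg g W := fun W => by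
    rw [norm_det_diracMatrix]
    exact Finset.prod_congr rfl fun g _ => (hFg g W).symm
  -- crux `TiltedFlatness` flavour by flavour, and (B) for the cofactor block
  have hK3 := fun g => hT β hβ (mq g) (hmq g).1 (hmq g).2 N hN U x y refit hrefit (Fg g) wt (hFg g)
    hwt haar hhaar
  have hBA := hB β hβ (mq f) (hmq f).1 (hmq f).2 N hN U x y refit hrefit A wt hA hwt haar hhaar _ rfl
  simp only [← hX, ← hA, hF, ← hFg]
  set Z : ℝ := ∫ W, wt W ∂haar with hZdef
  set MA : ℝ := (∫ W, A W * wt W ∂haar) / Z with hMAdef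
  set K : ℝ := C₃ * (1 + β) ^ p₃ with hKdef
  set KB : ℝ := C_B * (1 + β) ^ p_B with hKBdef
  obtain ⟨M, hM⟩ : ∃ M : Fin Nf → ℝ, ∀ g, M g = (∫ W, Fg g W * wt W ∂haar) / Z := ⟨_, fun _ => rfl⟩
  simp only [← hM] at hK3 ⊢
  -- continuity, positivity and integrability on the compact fibre
  have hrefc : Continuous refit := by
    rw [show refit = _ from funext fun W => funext fun e => hrefit W e]
    exact continuous_pi fun e => by split_ifs; exacts [continuous_apply e, continuous_const]
  have hDc : ∀ m : ℝ, Continuous fun W => wilsonDirac (fundamentalRep (Fin 3)) (refit W) m 1 :=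
    fun m => (continuous_wilsonDirac (fundamentalRep (Fin 3)) (continuous_fundamentalRep (Fin 3))
      m 1).comp hrefc
  have hFgc : ∀ g, Continuous (Fg g) := fun g => by
    rw [show Fg g = _ from funext (hFg g)]
    exact (hDc (mq g)).matrix_det.norm
  have hAc : Continuous A := by
    rw [show A = _ from funext hA]
    refine continuous_finsetSum _ fun a _ => continuous_finsetSum _ fun i _ =>
      continuous_finsetSum _ fun b _ => continuous_finsetSum _ fun j _ => ?_
    exact ((hDc (mq f)).matrix_adjugate.matrix_elem _ _).norm
  have hwtc : Continuous wt := by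
    rw [show wt = _ from funext hwt]
    exact Real.continuous_exp.comp ((continuous_const.mul
      ((TiltedFlatnessNegative.continuous_wilsonAction (fundamentalRep (Fin 3))
        (continuous_fundamentalRep (Fin 3))).comp hrefc)).neg)
  have hwt0 : ∀ W, 0 < wt W := fun W => by rw [hwt]; exact Real.exp_pos _
  have hFg0 : ∀ g W, 0 ≤ Fg g W := fun g W => by rw [hFg]; exact norm_nonneg _
  have hP0 : ∀ W, 0 ≤ ∏ g, Fg g W := fun W => Finset.prod_nonneg fun g _ => hFg0 g W
  have hA0 : ∀ W, 0 ≤ A W := fun W => by rw [hA]; positivity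
  have hPc : Continuous fun W => (∏ g, Fg g W) * wt W :=
    (continuous_finsetProd _ fun g _ => hFgc g).mul hwtc
  haveI : IsProbabilityMeasure haar := by rw [hhaar]; infer_instance
  have hint : ∀ {φ : GaugeConfig 4 N SU3 → ℝ}, Continuous φ → Integrable φ haar := fun hφ =>
    TiltedFlatnessNegative.integrable_of_continuous hφ
  have hZ : 0 < Z := by
    have hsupp : Function.support wt = Set.univ := Set.eq_univ_of_forall fun W => (hwt0 W).ne'
    rw [hZdef, integral_pos_iff_support_of_nonneg (fun W => (hwt0 W).le) (hint hwtc), hsupp,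
      measure_univ]
    exact one_pos
  set I : ℝ := ∫ W, (∏ g, Fg g W) * wt W ∂haar with hIdef
  have hI0 : 0 ≤ I := integral_nonneg fun W => mul_nonneg (hP0 W) (hwt0 W).le
  have hlin : ∫⁻ W, ENNReal.ofReal (∏ g, Fg g W) * ENNReal.ofReal (wt W) ∂haar = ENNReal.ofReal I := by
    rw [hIdef, ofReal_integral_eq_lintegral_ofReal (hint hPc)
      (ae_of_all _ fun W => mul_nonneg (hP0 W) (hwt0 W).le)]
    exact lintegral_congr fun W => (ENNReal.ofReal_mul (hP0 W)).symm
  -- degenerate fibre 1: the sea vanishes a.e., the left-hand side is `0`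
  rcases hI0.eq_or_lt with hI00 | hIpos
  · have hae : (fun W => (∏ g, Fg g W) * wt W) =ᵐ[haar] 0 :=
      (integral_eq_zero_iff_of_nonneg (fun W => mul_nonneg (hP0 W) (hwt0 W).le) (hint hPc)).1
        hI00.symm
    have h0 : ∫⁻ W, ENNReal.ofReal (∏ g, Fg g W) * ENNReal.ofReal (X W) ^ (-r) *
        ENNReal.ofReal (wt W) ∂haar = 0 := by
      refine (lintegral_congr_ae (hae.mono fun W hW => ?_)).trans lintegral_zero
      have hW0 : ∏ g, Fg g W = 0 := (mul_eq_zero.1 hW).resolve_right (hwt0 W).ne'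
      simp only [hW0, ENNReal.ofReal_zero, zero_mul]
    rw [h0]
    exact zero_le
  -- hence every one-flavour tilted mean is positive
  have hMpos : ∀ g, 0 < M g := by
    intro g
    rw [hM]
    refine div_pos ((integral_nonneg fun W => mul_nonneg (hFg0 g W) (hwt0 W).le).lt_of_ne' ?_) hZ
    intro hg0
    refine hIpos.ne' ((integral_eq_zero_iff_of_nonneg (fun W => mul_nonneg (hP0 W) (hwt0 W).le)
      (hint hPc)).2 ?_)
    have hae := (integral_eq_zero_iff_of_nonneg (fun W => mul_nonneg (hFg0 g W) (hwt0 W).le)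
      (hint ((hFgc g).mul hwtc))).1 hg0
    filter_upwards [hae] with W hW
    have hW0 : Fg g W = 0 := (mul_eq_zero.1 hW).resolve_right (hwt0 W).ne'
    rw [Pi.zero_apply, Finset.prod_eq_zero (f := fun g => Fg g W) (Finset.mem_univ g) hW0, zero_mul]
  have hMf : 0 < M f := hMpos f
  -- degenerate fibre 2: dead channel (`A = 0` a.e.), the right-hand side is `⊤`
  have hMA0 : 0 ≤ MA := div_nonneg (integral_nonneg fun W => mul_nonneg (hA0 W) (hwt0 W).le) hZ.le
  rcases hMA0.eq_or_lt with hMA00 | hMApos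
  · rw [← hMA00, zero_div, ENNReal.ofReal_zero, ENNReal.zero_rpow_of_neg (neg_lt_zero.2 hr),
      ENNReal.mul_top (ENNReal.ofReal_pos.2 (by positivity)).ne', hlin,
      ENNReal.top_mul (ENNReal.ofReal_pos.2 hIpos).ne']
    exact le_top
  -- Step 1: pointwise domination off the walls, `|det D| X^{-r} wt ≤ Q · A^{-r} wt`
  have h1β : 0 < 1 + β := by linarith
  have hK1 : 1 ≤ K := by
    rw [hKdef]; exact one_le_mul_of_one_le_of_one_le hC₃ (Real.one_le_rpow (by linarith) hp₃)
  have hKpos : 0 < K := one_pos.trans_le hK1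
  have hprodM : 0 ≤ ∏ g, M g := Finset.prod_nonneg fun g _ => (hMpos g).le
  set Q : ℝ := K ^ Nf * (∏ g, M g) * (K * M f) ^ r with hQdef
  have hQ0 : 0 ≤ Q := by positivity
  have key : ∀ W, ENNReal.ofReal (∏ g, Fg g W) * ENNReal.ofReal (X W) ^ (-r) *
      ENNReal.ofReal (wt W) ≤
      ENNReal.ofReal Q * (ENNReal.ofReal (A W) ^ (-r) * ENNReal.ofReal (wt W)) := by
    intro W
    rcases eq_or_ne (∏ g, Fg g W) 0 with h0 | h0
    · rw [h0, ENNReal.ofReal_zero, zero_mul, zero_mul]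
      exact zero_le
    have hg : ∀ g, Fg g W ≠ 0 := fun g => Finset.prod_ne_zero_iff.1 h0 g (Finset.mem_univ g)
    have hdet : ∀ g, (wilsonDirac (fundamentalRep (Fin 3)) (refit W) (mq g) 1).det ≠ 0 :=
      fun g => norm_ne_zero_iff.1 (by rw [← hFg]; exact hg g)
    have hDf : 0 < Fg f W := (hFg0 f W).lt_of_ne' (hg f)
    rw [hX W, blockSum_eq_div (refit W) mq f x y hdet, ← hA W, ← hFg f W,
      Literature.MeasureTheory.Integral.ofReal_mul_ofReal_div_rpow_neg (hP0 W) (hA0 W) hDf hr,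
      mul_assoc]
    refine mul_le_mul_left (ENNReal.ofReal_le_ofReal ?_) _
    have h1 : ∏ g, Fg g W ≤ K ^ Nf * ∏ g, M g :=
      calc ∏ g, Fg g W ≤ ∏ g, K * M g :=
            Finset.prod_le_prod (fun g _ => hFg0 g W) fun g _ => (hK3 g).1 W
        _ = K ^ Nf * ∏ g, M g := by
            rw [Finset.prod_mul_distrib, Finset.prod_const, Finset.card_univ, Fintype.card_fin]
    exact mul_le_mul h1 (Real.rpow_le_rpow (hFg0 f W) ((hK3 f).1 W) hr.le)
      (Real.rpow_nonneg (hFg0 f W) _) (by positivity)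
  -- Step 2: negative moments of the cofactor block from (B), by the layer cake
  have hKB0 : 0 ≤ KB := by rw [hKBdef]; positivity
  have hsbA : ∀ ε : ℝ, 0 < ε →
      ∫ W, (if A W ≤ ε * MA then (1 : ℝ) else 0) * wt W ∂haar ≤ KB * ε ^ c * Z := by
    intro ε hε
    have h := hBA hMApos ε hε
    rwa [div_le_iff₀ hZ] at h
  have hL1 := Literature.MeasureTheory.Integral.lintegral_rpow_neg_mul_le_of_smallBalls haar
    hAc.measurable hwtc.measurable hA0 (fun W => (hwt0 W).le) (hint hwtc) hMApos hKB0 hr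
    (by linarith : r < c) hsbA
  -- Step 3: reverse Hölder for the product of the one-flavour seas (union bound at `ε₀`)
  set L : ℝ := 2 * (Nf + 1) * K with hLdef
  have hL0 : 0 < L := by rw [hLdef]; positivity
  set ε₀ : ℝ := L ^ (-(1 / c₃)) with hε₀def
  have hε₀ : 0 < ε₀ := Real.rpow_pos_of_pos hL0 _
  have hε₀c : K * ε₀ ^ c₃ = 1 / (2 * (Nf + 1)) := by
    rw [hε₀def, ← Real.rpow_mul hL0.le, show -(1 / c₃) * c₃ = -1 by field_simp, Real.rpow_neg_one,
      hLdef]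
    field_simp
  have hsum : ∑ g, ∫ W, (if Fg g W ≤ ε₀ * M g then (1 : ℝ) else 0) * wt W ∂haar ≤ (1 / 2) * Z := by
    have hg : ∀ g, ∫ W, (if Fg g W ≤ ε₀ * M g then (1 : ℝ) else 0) * wt W ∂haar ≤
        (1 / (2 * (Nf + 1))) * Z := fun g => by
      have h := (hK3 g).2 (hMpos g) ε₀ hε₀
      rwa [div_le_iff₀ hZ, hε₀c] at h
    calc ∑ g, ∫ W, (if Fg g W ≤ ε₀ * M g then (1 : ℝ) else 0) * wt W ∂haar
        ≤ ∑ _g : Fin Nf, (1 / (2 * (Nf + 1))) * Z := Finset.sum_le_sum fun g _ => hg g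
      _ = Nf * ((1 / (2 * (Nf + 1))) * Z) := by
          rw [Finset.sum_const, Finset.card_univ, Fintype.card_fin, nsmul_eq_mul]
      _ ≤ ((Nf : ℝ) + 1) * ((1 / (2 * (Nf + 1))) * Z) :=
          mul_le_mul_of_nonneg_right (by linarith) (by positivity)
      _ = (1 / 2) * Z := by
          field_simp
  have hL2 := Literature.MeasureTheory.Integral.pow_mul_prod_mul_integral_le_of_smallBalls haar
    (F := Fg) (M := M) (fun g => (hFgc g).measurable) hFg0 (fun W => (hwt0 W).le) (hint hwtc)
    (hint hPc) (fun g => (hMpos g).le) hε₀.le hsum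
  rw [Fintype.card_fin] at hL2
  -- Step 4: the constants
  have hprodZ : (∏ g, M g) * Z ≤ 2 * I / ε₀ ^ Nf := by
    rw [le_div_iff₀ (pow_pos hε₀ _)]
    calc (∏ g, M g) * Z * ε₀ ^ Nf = ε₀ ^ Nf * (∏ g, M g) * Z := by ring
      _ ≤ 2 * I := hL2
  have hCneg : 1 + KB * (r / (c - r)) ≤ (1 + C_B) * (1 + β) ^ max p_B 0 := by
    have h1 : r / (c - r) ≤ 1 := by rw [div_le_one hcr0]; linarith
    have h2 : (1 + β) ^ p_B ≤ (1 + β) ^ max p_B 0 :=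
      Real.rpow_le_rpow_of_exponent_le (by linarith) (le_max_left _ _)
    have h3 : (1 : ℝ) ≤ (1 + β) ^ max p_B 0 := Real.one_le_rpow (by linarith) (le_max_right _ _)
    calc 1 + KB * (r / (c - r)) ≤ 1 + KB * 1 := by gcongr
      _ ≤ (1 + β) ^ max p_B 0 + C_B * (1 + β) ^ max p_B 0 := by rw [mul_one, hKBdef]; gcongr
      _ = (1 + C_B) * (1 + β) ^ max p_B 0 := by ring
  have hKr : K ^ r ≤ K := by
    conv_rhs => rw [← Real.rpow_one K]
    exact Real.rpow_le_rpow_of_exponent_le hK1 hr1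
  have hKpow : K ^ Nf * K = C₃ ^ (Nf + 1) * (1 + β) ^ (p₃ * (Nf + 1)) := by
    rw [← pow_succ, hKdef, mul_pow, ← Real.rpow_mul_natCast h1β.le, Nat.cast_add_one]
  have hε₀Nf : (ε₀ ^ Nf)⁻¹ =
      (2 * (Nf + 1) * C₃) ^ ((Nf : ℝ) / c₃) * (1 + β) ^ (p₃ * ((Nf : ℝ) / c₃)) := by
    rw [hε₀def, ← Real.rpow_natCast, ← Real.rpow_mul hL0.le, ← Real.rpow_neg hL0.le,
      show -(-(1 / c₃) * (Nf : ℝ)) = (Nf : ℝ) / c₃ by ring, hLdef, hKdef,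
      show 2 * ((Nf : ℝ) + 1) * (C₃ * (1 + β) ^ p₃) = 2 * (Nf + 1) * C₃ * (1 + β) ^ p₃ by ring,
      Real.mul_rpow (by positivity) (by positivity), ← Real.rpow_mul h1β.le]
  have hP : (1 + β) ^ P =
      (1 + β) ^ (p₃ * (Nf + 1)) * (1 + β) ^ max p_B 0 * (1 + β) ^ (p₃ * ((Nf : ℝ) / c₃)) := by
    rw [hPdef, Real.rpow_add h1β, Real.rpow_add h1β]
  have hconst : 2 * (K ^ Nf * K ^ r) * (1 + KB * (r / (c - r))) * (ε₀ ^ Nf)⁻¹ ≤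
      Cbig * (1 + β) ^ P := by
    calc 2 * (K ^ Nf * K ^ r) * (1 + KB * (r / (c - r))) * (ε₀ ^ Nf)⁻¹
        ≤ 2 * (K ^ Nf * K) * ((1 + C_B) * (1 + β) ^ max p_B 0) * (ε₀ ^ Nf)⁻¹ := by
          gcongr
      _ = Cbig * (1 + β) ^ P := by rw [hKpow, hε₀Nf, hP, hCbig]; ring
  have hratio : (K * M f) ^ r * MA ^ (-r) = K ^ r * (MA / M f) ^ (-r) := by
    rw [Real.mul_rpow hKpos.le hMf.le, Real.div_rpow hMApos.le hMf.le, Real.rpow_neg hMf.le,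
      div_inv_eq_mul]
    ring
  have hQ : Q * ((1 + KB * (r / (c - r))) * MA ^ (-r) * Z) ≤
      Cbig * (1 + β) ^ P * (MA / M f) ^ (-r) * I :=
    calc Q * ((1 + KB * (r / (c - r))) * MA ^ (-r) * Z)
        = K ^ Nf * ((K * M f) ^ r * MA ^ (-r)) * (1 + KB * (r / (c - r))) * ((∏ g, M g) * Z) := by
          rw [hQdef]; ring
      _ = (K ^ Nf * K ^ r) * (1 + KB * (r / (c - r))) * (MA / M f) ^ (-r) * ((∏ g, M g) * Z) := by
          rw [hratio]; ring
      _ ≤ (K ^ Nf * K ^ r) * (1 + KB * (r / (c - r))) * (MA / M f) ^ (-r) * (2 * I / ε₀ ^ Nf) :=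
          mul_le_mul_of_nonneg_left hprodZ (by positivity)
      _ = 2 * (K ^ Nf * K ^ r) * (1 + KB * (r / (c - r))) * (ε₀ ^ Nf)⁻¹ *
            ((MA / M f) ^ (-r) * I) := by rw [div_eq_mul_inv]; ring
      _ ≤ Cbig * (1 + β) ^ P * ((MA / M f) ^ (-r) * I) :=
          mul_le_mul_of_nonneg_right hconst (by positivity)
      _ = Cbig * (1 + β) ^ P * (MA / M f) ^ (-r) * I := by ring
  -- Step 5: the chain in `ℝ≥0∞`
  have ha : 0 ≤ Cbig * (1 + β) ^ P := by positivity
  have hb : 0 ≤ Cbig * (1 + β) ^ P * (MA / M f) ^ (-r) := by positivity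
  calc ∫⁻ W, ENNReal.ofReal (∏ g, Fg g W) * ENNReal.ofReal (X W) ^ (-r) * ENNReal.ofReal (wt W) ∂haar
      ≤ ∫⁻ W, ENNReal.ofReal Q * (ENNReal.ofReal (A W) ^ (-r) * ENNReal.ofReal (wt W)) ∂haar :=
        lintegral_mono key
    _ = ENNReal.ofReal Q * ∫⁻ W, ENNReal.ofReal (A W) ^ (-r) * ENNReal.ofReal (wt W) ∂haar :=
        lintegral_const_mul' _ _ ENNReal.ofReal_ne_top
    _ ≤ ENNReal.ofReal Q * ENNReal.ofReal ((1 + KB * (r / (c - r))) * MA ^ (-r) * Z) :=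
        mul_le_mul_right hL1 _
    _ = ENNReal.ofReal (Q * ((1 + KB * (r / (c - r))) * MA ^ (-r) * Z)) :=
        (ENNReal.ofReal_mul hQ0).symm
    _ ≤ ENNReal.ofReal (Cbig * (1 + β) ^ P * (MA / M f) ^ (-r) * I) := ENNReal.ofReal_le_ofReal hQ
    _ = ENNReal.ofReal (Cbig * (1 + β) ^ P) * ENNReal.ofReal (MA / M f) ^ (-r) *
          ∫⁻ W, ENNReal.ofReal (∏ g, Fg g W) * ENNReal.ofReal (wt W) ∂haar := by
        rw [ENNReal.ofReal_mul hb, ENNReal.ofReal_mul ha, hlin,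
          ENNReal.ofReal_rpow_of_pos (div_pos hMApos hMf)]

end Summit.QuantumFields.QCD.Theorems.AdjugateAnticoncentrationPin

end
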